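import Literature.AnabelianGeometry.SemiGraphs.Temperoids
import Literature.AnabelianGeometry.SemiGraphs.BTempStructureProofs
import HarnessLib

/-!
# Semi-graphs of anabelioids, §3: connected objects of `B^temp(Π)` are coset spaces

Mochizuki, *Semi-graphs of anabelioids*, Publ. RIMS **42** (2006), §3, Remark 3.1.2 p. 33
[cite: MochizukiSemiAnbd2006, Rmk 3.1.2 p.33]: for `Π` tempered "the `Π`-set `Π/H` forms an object
of `B^temp(Π)` if and only if `H` is open", and the morphisms between such objects are the
cosets `h H₂` with `h⁻¹ H₁ h ⊆ H₂` — so that every connected object of `B^temp(Π)` (a transitive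
`Π`-set, `BTemp.isConnectedObj_iff`) is isomorphic to the coset object `Π/Stab(x)` of any of its
points.  This proof-only file records that identification over t2's `BTemp.quotientObj`
(`Temperoids.lean`):

* `BTemp.nonempty_quotientObj_iso` — for `Π` tempered, `X` an object of `B^temp(Π)` on which `Π`
  acts transitively, `x ∈ X` and `H` the stabiliser of `x` (an open subgroup), the orbit map
  `Π/H → X`, `gH ↦ g · x`, is an isomorphism `BTemp.quotientObj Π hΠ H _ ≅ X`;
* `BTemp.nonempty_quotientObj_iso_of_isConnectedObj` — the same for a connected object.

Proof-only: no definitions.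
-/

namespace Literature.AnabelianGeometry.SemiGraphs

open CategoryTheory CategoryTheory.Limits Topology
open Literature.AlgebraicGeometry.Frobenioids (IsConnectedObj)

universe u

variable {G : Type u} [Group G] [TopologicalSpace G] [IsTopologicalGroup G]

omit [IsTopologicalGroup G] in
/-- Equivariance of a morphism of `B^temp(Π)`, pointwise. [folklore] -/
private theorem hom_ρ₁ {X Y : BTemp G} (f : X ⟶ Y) (g : G) (x : X.obj.V) :
    f.hom.hom (X.obj.ρ g x) = Y.obj.ρ g (f.hom.hom x) := by
  have e := ConcreteCategory.congr_hom (f.hom.comm g) x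
  simp only [types_comp_apply] at e
  exact e

/-- **Transitive objects of `B^temp(Π)` are coset spaces** ([SemiAnbd] Rmk 3.1.2): for `Π` tempered,
`X ∈ B^temp(Π)` transitive, `x ∈ X` with (open) stabiliser `H`, the orbit map `gH ↦ g · x` is an
isomorphism `Π/H ≅ X` in `B^temp(Π)`. [cite: MochizukiSemiAnbd2006, Rmk 3.1.2 p.33] -/
theorem BTemp.nonempty_quotientObj_iso (hG : IsTempered G) (X : BTemp G) (x : X.obj.V)
    (htrans : ∀ y : X.obj.V, ∃ g : G, X.obj.ρ g x = y) (H : Subgroup G)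
    (hH : ∀ g : G, g ∈ H ↔ X.obj.ρ g x = x) :
    ∃ hHo : IsOpen (H : Set G), Nonempty (BTemp.quotientObj G hG H hHo ≅ X) := by
  classical
  letI : MulAction G X.obj.V := Action.instMulAction X.obj
  have hHo : IsOpen (H : Set G) := by
    have : (H : Set G) = {g : G | X.obj.ρ g x = x} := Set.ext fun g => hH g
    rw [this]
    exact X.property.2 x
  refine ⟨hHo, ?_⟩
  -- the orbit map and its bijectivity
  let θ : G ⧸ H → X.obj.V := fun q => Quotient.liftOn' q (fun g : G => g • x) fun g g' h => by
    have h' : g⁻¹ * g' ∈ H := QuotientGroup.leftRel_apply.mp h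
    have hfix : (g⁻¹ * g') • x = x := (hH _).mp h'
    rw [mul_smul, inv_smul_eq_iff] at hfix
    exact hfix.symm
  have θ_mk : ∀ g : G, θ (g : G ⧸ H) = g • x := fun _ => rfl
  have θ_bij : Function.Bijective θ := by
    constructor
    · intro q q' hqq'
      obtain ⟨g, rfl⟩ := QuotientGroup.mk_surjective q
      obtain ⟨g', rfl⟩ := QuotientGroup.mk_surjective q'
      rw [θ_mk, θ_mk] at hqq'
      apply QuotientGroup.eq.mpr
      apply (hH _).mpr
      change (g⁻¹ * g') • x = x
      rw [mul_smul, ← hqq', inv_smul_smul]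
    · intro y
      obtain ⟨g, hg⟩ := htrans y
      exact ⟨(g : G ⧸ H), hg⟩
  let e : G ⧸ H ≃ X.obj.V := Equiv.ofBijective θ θ_bij
  -- equivariance
  have θ_smul : ∀ (g : G) (q : G ⧸ H), θ (g • q) = g • θ q := by
    intro g q
    obtain ⟨k, rfl⟩ := QuotientGroup.mk_surjective q
    rw [MulAction.Quotient.smul_coe, smul_eq_mul, θ_mk, θ_mk, mul_smul]
  refine ⟨ObjectProperty.isoMk _ (Action.mkIso e.toIso fun g => ?_)⟩
  apply ConcreteCategory.hom_ext
  intro (q : G ⧸ H)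
  change θ (g • q) = g • θ q
  exact θ_smul g q

/-- **Connected objects of `B^temp(Π)` are coset spaces** ([SemiAnbd] Rmk 3.1.2 with
`BTemp.isConnectedObj_iff`): for `Π` tempered and `X` connected with a point `x`, `X ≅ Π/Stab(x)`.
[cite: MochizukiSemiAnbd2006, Rmk 3.1.2 p.33] -/
theorem BTemp.nonempty_quotientObj_iso_of_isConnectedObj (hG : IsTempered G) (X : BTemp G)
    (hX : IsConnectedObj X) (x : X.obj.V) (H : Subgroup G) (hH : ∀ g : G, g ∈ H ↔ X.obj.ρ g x = x) :
    ∃ hHo : IsOpen (H : Set G), Nonempty (BTemp.quotientObj G hG H hHo ≅ X) :=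
  BTemp.nonempty_quotientObj_iso hG X x (fun y => ((BTemp.isConnectedObj_iff X).mp hX).2 x y) H hH

end Literature.AnabelianGeometry.SemiGraphs
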